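import Summits.QuantumFields.BalabanUV.T4Continuum.Spine.NE1p.DressedSmallFieldLabelCountsMu
import Summits.QuantumFields.BalabanUV.T4Continuum.Spine.NE1p.DressedSmallFieldInnerLink

/-!
# T⁴ programme, spine estimate NE1′ (node O3b/H2) — THE μ-TWIN OF S40: ROAD P1's SOURCE-PENCIL ENDs AT THE INNER-LABEL AND
# OUTER-LABEL INDICES WITH THE (2.27)-LINK BINDER DISCHARGED — N0x PART 2's `muPart_locE_le_of_coresAt_pencil_innerLabels` ∕
# `…_outerLabels` re-fired ONCE EACH WITHOUT `hlink`: on step geometries whose cubes are footprints of unit domains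
# (`c₃₂ = c' = 5 + u₀`, S40 PART 1 §1 `link_of_ineq227` ∕ `link_of_ineq227'`) and on pv22's torus `tsys 4 N` (`c₃₂ = c' = 5`,
# NO geometry hypothesis, NO `hmono`, located numerals)

Cell `pub-balaban`, sub-cell `t4`, BINDER-OWNERS row NE1′ (owner lineage t4-ne1p-p1, road P1 «RG-trajectory comparison … μ-uniformity
through the printed small-field bounds»); crew seat `b2b-balaban-t4-ne1p-formalise-leaf-07` (LEAF PROVER 07, generation 20); crew
S-row **S66 ∕ DAG N29zzzzzk** (own-initiative follower of this lineage's S40 = DAG N29zzl under R-T61 (ii); INTENT + PROTOTYPE +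
STAGED `HOME/CLAIMS.log` l.24609, owner GO l.24620 (2b), BOOKED typer gen 9 **R-T153** l.24791 (cap 399, ONE kernel slot), v1 =
p244344 LANDED l.24765, cross-read **X241** ok (leaf-05-g13, l.24970); v1.1 = this header's row-id tokens ONLY, code byte-identical).
ADDITIVE — imports the owner's N0x PART 2
`Spine/NE1p/DressedSmallFieldLabelCountsMu` (p236238 ✓✓; → N0x PART 1 → N0w → N0v → N0u → … → N0p) and this lineage's S40 PART 1
`Spine/NE1p/DressedSmallFieldInnerLink` (p233343 ✓✓; → N0u, S24 `K₀_four`, N0o `torus_consts`) ONLY; THEOREMS ONLY (0 `def`,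
0 `def … : Prop`, 0 cite); nothing of N0x ∕ N0u ∕ N0v ∕ N0s ∕ S40 ∕ S24 ∕ N0o ∕ pv22 is restated — `muPart_locE_le_of_coresAt_pencil_innerLabels`
∕ `muPart_locE_le_of_coresAt_pencil_outerLabels` (N0x P2), `link_of_ineq227` ∕ `link_of_ineq227'` (S40.1 §1), `torus_consts` (N0o),
`K₀_four` (S24), `torusTreeLen_singleton` (pv22) are used BY NAME, each END EXACTLY ONCE.

WHY THIS FILE.  S40 (PART 1 §3∕§4 `attachedPart_locE_le_of_coresAt_pencil_innerLabels_of_units` ∕ `_torus`, PART 2 §1∕§2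
`attachedPart_locE_le_of_coresAt_pencil_outerLabels_of_units` ∕ `_torus`) discharged the owner's displayed (2.27)∘(2.32)- and
(2.27)∘(2.37)-KIND link binders `hlink` of N0u's and N0v's ENDs for the ATTACHED PART (table pencil `h₀ + σ • w`): the link IS the
geometry's own (2.27) `ineq227` on the family augmented by the uncovered cubes adjoined as unit domains, constant `5 + u₀` (`5` on the
torus, SHARP — S40.1 `link_torus_const_sharp`).  The owner's N0x PART 2 (road P1's sentence «μ enters (B3) through the amplitude
ALONE; the count is μ-free») typed the SOURCE-PENCIL twins of those ENDs (`h₀ + s • v`, `‖s‖ < μ₁`; Schwarz on the source disc) with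
`hlink` DISPLAYED — its header says «`hlink` (S40 supplies it)».  This file is that supply, the μ-twin of S40 nobody filed (tree grep at
INTENT: `muPart_locE_le_of_coresAt_pencil_innerLabels` ∕ `_outerLabels` are consumed only by N0z `DressedSmallFieldComponentInnerMu`
(component indices) and its nested-tori face; N0y ∕ S53 work at row NE5's record-label index):
* §1 **`muPart_locE_le_of_coresAt_pencil_innerLabels_of_units`** — N0x P2's inner-label μ-END ONCE BY NAME, every binder VERBATIM
  except `hlink ↦ (unit, hcubes, hu₀)` (the scale-`k` geometry's cubes are footprints of unit domains of size `≤ u₀`), supplied by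
  S40.1 `link_of_ineq227` at `foot Z`, and `c₃₂ ↦ 5 + u₀` inside `hRR` (`u := e^{R(5+u₀)}·s·e^{b₀t}`);
* §2 **`muPart_locE_le_of_coresAt_pencil_outerLabels_of_units`** — N0x P2's outer-label μ-END ONCE BY NAME, `hlink ↦ (unit, hcubes,
  hu₀)` on the step geometry itself, supplied by S40.1 `link_of_ineq227'`, and `c' ↦ 5 + u₀` inside `hRR` (`u := vW·e^{R(5+u₀)}`);
* §3 **`muPart_locE_le_of_coresAt_pencil_innerLabels_torus`** — §1 at `D = Dk := tsys 4 N`, `G = Gk := tgeometry 4 N`, `foot := id`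
  (`hmono` by `le_rfl`), unit domains the single cubes (`u₀ = 0`, so `c₃₂ = 5`), letters located by `torus_consts` ∕ `K₀_four`
  (`ν = 9`, `κ₀ = 64·log 162`, `c₁ = 64`, `K₀ = K₀(64,8)`; `b₅ := 5·r₁`): NO link binder, NO geometry hypothesis, NO `hmono`;
* §4 **`muPart_locE_le_of_coresAt_pencil_outerLabels_torus`** — §2 at `D := tsys 4 N`, `G := tgeometry 4 N`, `u₀ = 0` (`c' = 5`),
  letters located: NO link binder, NO geometry hypothesis.
In all four the source (`μ₁`, `μ₀`, `sμ`, `v`) occurs ONLY in `hH`, `hact`, `hAmp` and the conclusion — in no count binder and, after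
this file, in NO link binder either; conclusions LITERALLY N0x P2's (§1∕§2) ∕ in the crew's torus currency
`e·9·64·K₀(64,8)²·A·e^{−r₁·torusTreeLen X₀}·μ₀∕(μ₁ − μ₀)` (§3∕§4; S53's μ-currency at the record-label index).

PRINTED LOCI (TYPE ∕ CONTEXT only — [Balaban1988RGII] = T. Bałaban, Renormalization group approach to lattice gauge field theories.
II, Commun. Math. Phys. 116 (1988) 1–22: p. 18 (2.27) `d_k(Z₀) + 5 ≤ Σ(d_k(Y) + 5)`, (2.29), (2.32); p. 19 (2.35)–(2.37); p. 20 C₃,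
Lemma 3 (2.38) — quoted VERBATIM in the imported owner ∕ S40 headers from the renders `b2b-balaban-ref1/pages/1988-cmp116-rg-II-
cluster/…-p017…p020-x2.png` (t4-ref2 pass 86 C-t4r2-407); no new render reading is claimed here).  §2 of [Balaban1988RGII] carries NO
observable and NO source: the μ-parts are the owner's extension (GAPS-T4 C-t4r2-340 (n1) NEW-UNPRINTED; (n2) the strict sub-window
`μ₀ < μ₁`).  Print's (2.32) constant `4` vs the typed `5` = S40's record (GAPS G-B13-08), TYPE∕CONTEXT.  Nothing here is used as a
fact about Bałaban's densities.
WHAT STAYS DISPLAYED (binders, by name; NOTHING instantiated on Bałaban's densities): the room, operator conditions `hm`∕`hN`∕`hq`, class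
radii (source radius `μ₁‖v‖` in `hH`); (B1b)'s residue `terms`∕`emb`∕`hscale`∕`hact` and `hadm` ((B1b) READING: the terms of `Z` ARE
inner ∕ outer labels admissible in print's sense); (B3-form) `hAmp` — THE place where the dressed radius and the source enter, p. 18's
clause KIND at `C₃(E₀ + D₀)`, NOT asserted (G-ne9p2-5 UNPRINTED); §2∕§4's member bound `hmember` ((2.36)∕(1.28) KIND) and inner data
`J`∕`n`; `bondsOf`∕`hb₀`, `hs0`∕`hs1`∕`ht`; the clauses `κ₀ + 1 ≤ δκ` ∕ `κ₀ + 1 ≤ r`, `e·K₀·c₁·α₆ ≤ 1` ∕ `e·K₀·c₁·a ≤ 1`,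
`r₁ + 2κ₀ + 2 ≤ Rkp ≤ R − c₁·u`, `A·e^{b₅+1}·K₀·ν·c₁ ≤ 1` ((B5) SHAPES; on the torus these ARE pv22's cite-tagged `ineq229_torus_unit`
letters — their standing against print's NUMBERS is NOT asserted); the μ-window `0 < μ₀ < μ₁`, `‖sμ‖ ≤ μ₀`.  WHICH torus is
Bałaban's `T_η` and which side `N` stay pv22's READING (DIVERGENCE D-pv22.3), not asserted.

HONEST FRAMING (c3∕c4∕c6∕k1–k3).  Kernel bookkeeping: four by-name compositions over hypothesis SHAPES — the owner's N0x P2 μ-ENDs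
with this lineage's landed link lemmas plugged in; the cores ∕ labels are the cell's typed FORMAT of (2.14) and of print's resummation
indices, NOT Bałaban's functions; `G`, `Gk` are `Geometry` HYPOTHESIS structures in §1∕§2 and pv22's PROVED torus geometry in §3∕§4;
0 binders instantiated on Bałaban's (2.14) data; no new inequality beyond S40.1's (2.27)-on-the-augmented-family; (B1b) ∕ (B3-amp) ∕
(B3-form) ∕ (B5) for Bałaban's objects NOT discharged; no wall item moves; the NE1′ wall wording of record v1.8 (T4-DAG v48–v53) —
words, not kind — does NOT move; R-t4r2-Q2 NOT met thereby; NE1′ ⇐ the named binders — NOT proved, NOT printed; spine PROVED 0∕9;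
count 9 unchanged.  ABSOLUTE RULE honoured: printed loci are TYPE ∕ CONTEXT only, never hypothesis-free facts; nothing internally
minted is cited; [folklore] tags on kernel lemmas only; no placeholders.  `FlowStep.BetaPertH` ∕ (B) ∕ (B^μ) ∕ G-an2-4 enter nowhere.
Rung (B)+1 on ONE finite four-torus — NOT infinite volume, NOT a mass gap, NOT OS on ℝ⁴, NOT Clay.  HONEST DEPENDENCY: continuum YM on
T⁴ ⇐ BetaPertH ∧ nine spine estimates (0/9 proved); BetaPertH ⇐ (D1) ∧ (D4) ∧ CAP+tail; G-an2-4 gates asym, D1 and NE2/3/4. -/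
noncomputable section

namespace Summit.QuantumFields.BalabanUV.T4Continuum.NE1p.DressedSmallFieldLinkMu

open Metric Set Complex MeasureTheory
open scoped BigOperators
open Literature.MathematicalPhysics.QuantumFieldTheory.Balaban1983to89 (LocDomainSys)
open Literature.MathematicalPhysics.QuantumFieldTheory.Balaban1983to89.B13FamilySum (coveringFamilies)
open Literature.MathematicalPhysics.QuantumFieldTheory.Balaban1983to89.T4OutputRate (Carriers)
open Literature.MathematicalPhysics.QuantumFieldTheory.Balaban1983to89.B13Resummation (locE Geometry)
open Literature.MathematicalPhysics.QuantumFieldTheory.Balaban1983to89.B12TreeDecay (K₀)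
open Literature.MathematicalPhysics.QuantumFieldTheory.Balaban1983to89.TreeLengthTorus (TPt TDom IsTDom tsys torusTreeLen
  torusTreeLen_singleton)
open Literature.MathematicalPhysics.QuantumFieldTheory.Balaban1983to89.TreeLengthTorusGeometry (TTouch tgeometry)
open Summit.QuantumFields.BalabanUV.T4Continuum.B13HistMeasurable (MeasPotFrame B13HistM)
open Summit.QuantumFields.BalabanUV.T4Continuum.B13TermParamGaussianBi (BiCore)
open Summit.QuantumFields.BalabanUV.T4Continuum.NE1p.DressedSmallFieldGeometry (torus_consts)
open Summit.QuantumFields.BalabanUV.T4Continuum.NE1p.DressedSmallFieldGeometryFaces (K₀_four)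
open Summit.QuantumFields.BalabanUV.T4Continuum.NE1p.DressedSmallFieldInnerLink (link_of_ineq227 link_of_ineq227')
open Summit.QuantumFields.BalabanUV.T4Continuum.NE1p.DressedSmallFieldLabelCountsMu (muPart_locE_le_of_coresAt_pencil_innerLabels
  muPart_locE_le_of_coresAt_pencil_outerLabels)

/-! ## §1∕§2 THE μ-ENDs WITH THE LINK BINDER DISCHARGED (abstract geometries whose cubes are footprints of unit domains) -/

section End

variable {C : Carriers} {P : MeasPotFrame C} {Op : Type*} [NormedAddCommGroup Op] [NormedSpace ℂ Op]
variable (D : LocDomainSys) {Cube : Type} [DecidableEq Cube] (G : Geometry D Cube)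

section Inner

variable {Dk : LocDomainSys} {CubeK : Type} [DecidableEq CubeK] {Bnd : Type} [DecidableEq Bnd] (Gk : Geometry Dk CubeK)
  {𝒴 : ℕ → (Σ _ : Finset CubeK, Finset Dk.Dom × Finset Bnd) → Type*} {dom : ∀ k i, 𝒴 k i → C.Dom}
  {β : ℕ → (Σ _ : Finset CubeK, Finset Dk.Dom × Finset Bnd) → Type*} [∀ k i, MeasurableSpace (β k i)]
  {α : ℕ → (Σ _ : Finset CubeK, Finset Dk.Dom × Finset Bnd) → Type*} [∀ k i, NormedAddCommGroup (α k i)]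
  [∀ k i, InnerProductSpace ℝ (α k i)] [∀ k i, FiniteDimensional ℝ (α k i)] [∀ k i, MeasurableSpace (α k i)]
  [∀ k i, BorelSpace (α k i)]

open Classical in
/-- **N0x P2's INNER-LABEL μ-END WITHOUT THE LINK BINDER** (kernel; the owner's `muPart_locE_le_of_coresAt_pencil_innerLabels` ONCE
BY NAME, every binder VERBATIM except: `hlink ↦ (unit, hcubes, hu₀)` — the scale-`k` geometry's cubes are footprints of unit domains
of size `≤ u₀` — supplied by S40.1's `link_of_ineq227` at `foot Z`, and `c₃₂ ↦ 5 + u₀` inside the rate bookkeeping `hRR`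
(`u := e^{R(5+u₀)}·s·e^{b₀t}`).  The source (`v`, `μ₁`, `μ₀`, `sμ`) enters ONLY `hH`, `hact`, `hAmp` and the conclusion.  For
`0 < μ₀ < μ₁`, `‖sμ‖ ≤ μ₀`: `‖E[act sμ](X₀) − E[act 0](X₀)‖ ≤ (e ν c₁ K₀²·A·e^{−r₁ d(X₀)})·μ₀∕(μ₁ − μ₀)` — LITERALLY N0x P2's.
[folklore] -/
theorem muPart_locE_le_of_coresAt_pencil_innerLabels_of_units {Win : Set (ℕ → ℝ)}
    {ctr : ℕ → (ℕ → ℝ) → C.BgB → Op × B13HistM P} {ROp RHist R' : ℕ → ℝ}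
    (𝔊 : ∀ k i, C.Dom → BiCore P (dom k i) Op (β k i) (α k i))
    {mq bq N₀ : ℕ → (Σ _ : Finset CubeK, Finset Dk.Dom × Finset Bnd) → C.Dom → ℝ}
    (hroom : ∀ k, ROp k < R' k)
    (hm : ∀ k, ∀ g ∈ Win, ∀ (U : C.BgB) (X : C.Dom), C.scale X = k → ∀ i, 0 < mq k i X)
    (hN : ∀ k, ∀ g ∈ Win, ∀ (U : C.BgB) (X : C.Dom), C.scale X = k → ∀ i,
      (∀ o ∈ ball (ctr k g U).1 (R' k), AEStronglyMeasurable ((𝔊 k i X).N o) (𝔊 k i X).lam) ∧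
      (∀ p, DifferentiableOn ℂ (fun o => (𝔊 k i X).N o p) (ball (ctr k g U).1 (R' k))) ∧
      (∀ o ∈ ball (ctr k g U).1 (R' k), ∀ p, ‖(𝔊 k i X).N o p‖ ≤ N₀ k i X))
    (hq : ∀ k, ∀ g ∈ Win, ∀ (U : C.BgB) (X : C.Dom), C.scale X = k → ∀ i,
      (∀ o ∈ ball (ctr k g U).1 (R' k),
        AEStronglyMeasurable (Function.uncurry ((𝔊 k i X).q o)) ((𝔊 k i X).lam.prod volume)) ∧
      (∀ p v, DifferentiableOn ℂ (fun o => (𝔊 k i X).q o p v) (ball (ctr k g U).1 (R' k))) ∧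
      (∀ o ∈ ball (ctr k g U).1 (R' k), ∀ p v, mq k i X * ‖v‖ ^ 2 - bq k i X ≤ ((𝔊 k i X).q o p v).re))
    {k : ℕ} {g : ℕ → ℝ} (hg : g ∈ Win) {U : C.BgB} {o : Op} {h₀ v : B13HistM P} {μ₁ : ℝ}
    (hO : ‖o - (ctr k g U).1‖ ≤ ROp k) (hH : ‖h₀ - (ctr k g U).2‖ + μ₁ * ‖v‖ ≤ RHist k)
    {emb : D.Dom → C.Dom} (hscale : ∀ Z, C.scale (emb Z) = k)
    {terms : D.Dom → Finset (Σ _ : Finset CubeK, Finset Dk.Dom × Finset Bnd)} {act : ℂ → D.Dom → ℂ}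
    (hact : ∀ σ ∈ ball (0 : ℂ) μ₁, ∀ Z, act σ Z = ∑ i ∈ terms Z, (𝔊 k i (emb Z)).termAt o (h₀ + σ • v))
    {A Rkp r₁ b₅ μ₀ : ℝ} {X₀ : D.Dom} {sμ : ℂ} (hA : 0 ≤ A) (hr₁ : 0 ≤ r₁) (hb : r₁ * 5 ≤ b₅)
    (hrate : r₁ + 2 * G.κ₀ + 2 ≤ Rkp) (hsmall : A * Real.exp (b₅ + 1) * G.K₀ * G.ν * G.c₁ ≤ 1)
    (foot : D.Dom → Dk.Dom) (hmono : ∀ Z, D.dj Z ≤ Dk.dj (foot Z)) (bondsOf : Finset CubeK → Finset Bnd)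
    {δ κ α₆ R b₀ s t : ℝ} (hα₆ : 0 ≤ α₆) (hκ : Gk.κ₀ + 1 ≤ δ * κ) (h229 : Real.exp 1 * Gk.K₀ * Gk.c₁ * α₆ ≤ 1)
    (hs0 : 0 ≤ s) (hs1 : s ≤ 1) (ht : 0 ≤ t) (hb₀ : ∀ W, ((bondsOf W).card : ℝ) ≤ b₀ * W.card)
    (unit : CubeK → Dk.Dom) (hcubes : ∀ c, Gk.cubes (unit c) = {c}) {u₀ : ℝ} (hu₀ : ∀ c, Dk.dj (unit c) ≤ u₀)
    (hRR : Rkp ≤ R - Gk.c₁ * (Real.exp (R * (5 + u₀)) * s * Real.exp (b₀ * t)))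
    (hadm : ∀ Z, ∀ l ∈ terms Z, l.1 ⊆ Gk.cubes (foot Z) ∧
      l.2.1 ∈ coveringFamilies Finset.univ Gk.cubes (Gk.cubes (foot Z) \ l.1) ∧ l.2.2 ⊆ bondsOf l.1 ∧ l.1.card ≤ 2 * l.2.2.card)
    (hAmp : ∀ Z, G.cubes Z ⊆ G.cubes X₀ → ∀ l ∈ terms Z,
      (𝔊 k l (emb Z)).lam.real univ * ((𝔊 k l (emb Z)).wB * N₀ k l (emb Z) * Real.exp (bq k l (emb Z))) *
          (Real.pi / (mq k l (emb Z) / 2)) ^ (Module.finrank ℝ (α k l) / 2 : ℝ) *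
        Real.exp ((𝔊 k l (emb Z)).N₁ * (‖h₀‖ + μ₁ * ‖v‖)) ≤
      A * ((∏ Y ∈ l.2.1, (α₆ * Real.exp (-(δ * κ * Dk.dj Y)) * Real.exp (-(R * (Dk.dj Y + 5))))) *
        (s ^ 2 * t) ^ l.2.2.card))
    (h0 : 0 < μ₀) (h01 : μ₀ < μ₁) (hμ : ‖sμ‖ ≤ μ₀) :
    ‖locE G.ι G.cubes (act sμ) (G.cubes X₀) - locE G.ι G.cubes (act 0) (G.cubes X₀)‖ ≤
      Real.exp 1 * G.ν * G.c₁ * G.K₀ ^ 2 * A * Real.exp (-(r₁ * D.dj X₀)) * (μ₀ / (μ₁ - μ₀)) :=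
  muPart_locE_le_of_coresAt_pencil_innerLabels D G Gk 𝔊 hroom hm hN hq hg hO hH hscale hact hA hr₁ hb hrate hsmall foot hmono
    bondsOf hα₆ hκ h229 hs0 hs1 ht hb₀ hRR (fun Z W hW Df hDf => link_of_ineq227 Gk unit hcubes hu₀ (foot Z) W hW Df hDf) hadm hAmp
    h0 h01 hμ

end Inner

section Outer

variable {κ : D.Dom → Type}
  {𝒴 : ℕ → (Σ _ : Finset Cube, Σ F : Finset D.Dom, ∀ Z ∈ F, κ Z) → Type*} {dom : ∀ k i, 𝒴 k i → C.Dom}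
  {β : ℕ → (Σ _ : Finset Cube, Σ F : Finset D.Dom, ∀ Z ∈ F, κ Z) → Type*} [∀ k i, MeasurableSpace (β k i)]
  {α : ℕ → (Σ _ : Finset Cube, Σ F : Finset D.Dom, ∀ Z ∈ F, κ Z) → Type*} [∀ k i, NormedAddCommGroup (α k i)]
  [∀ k i, InnerProductSpace ℝ (α k i)] [∀ k i, FiniteDimensional ℝ (α k i)] [∀ k i, MeasurableSpace (α k i)]
  [∀ k i, BorelSpace (α k i)]

open Classical in
/-- **N0x P2's OUTER-LABEL μ-END WITHOUT THE LINK BINDER** (kernel; the owner's `muPart_locE_le_of_coresAt_pencil_outerLabels` ONCE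
BY NAME, every binder VERBATIM except `hlink ↦ (unit, hcubes, hu₀)` — the step geometry's cubes are footprints of unit domains of size
`≤ u₀` — supplied by S40.1's `link_of_ineq227'`, and `c' ↦ 5 + u₀` inside `hRR` (`u := vW·e^{R(5+u₀)}`).  `hmember` (the
(2.36)∕(1.28)-KIND member bound) and `hAmp` DISPLAYED as there; the source enters ONLY `hH`, `hact`, `hAmp` and the conclusion —
LITERALLY N0x P2's. [folklore] -/
theorem muPart_locE_le_of_coresAt_pencil_outerLabels_of_units {Win : Set (ℕ → ℝ)}
    {ctr : ℕ → (ℕ → ℝ) → C.BgB → Op × B13HistM P} {ROp RHist R' : ℕ → ℝ}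
    (𝔊 : ∀ k i, C.Dom → BiCore P (dom k i) Op (β k i) (α k i))
    {mq bq N₀ : ℕ → (Σ _ : Finset Cube, Σ F : Finset D.Dom, ∀ Z ∈ F, κ Z) → C.Dom → ℝ}
    (hroom : ∀ k, ROp k < R' k)
    (hm : ∀ k, ∀ g ∈ Win, ∀ (U : C.BgB) (X : C.Dom), C.scale X = k → ∀ i, 0 < mq k i X)
    (hN : ∀ k, ∀ g ∈ Win, ∀ (U : C.BgB) (X : C.Dom), C.scale X = k → ∀ i,
      (∀ o ∈ ball (ctr k g U).1 (R' k), AEStronglyMeasurable ((𝔊 k i X).N o) (𝔊 k i X).lam) ∧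
      (∀ p, DifferentiableOn ℂ (fun o => (𝔊 k i X).N o p) (ball (ctr k g U).1 (R' k))) ∧
      (∀ o ∈ ball (ctr k g U).1 (R' k), ∀ p, ‖(𝔊 k i X).N o p‖ ≤ N₀ k i X))
    (hq : ∀ k, ∀ g ∈ Win, ∀ (U : C.BgB) (X : C.Dom), C.scale X = k → ∀ i,
      (∀ o ∈ ball (ctr k g U).1 (R' k),
        AEStronglyMeasurable (Function.uncurry ((𝔊 k i X).q o)) ((𝔊 k i X).lam.prod volume)) ∧
      (∀ p v, DifferentiableOn ℂ (fun o => (𝔊 k i X).q o p v) (ball (ctr k g U).1 (R' k))) ∧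
      (∀ o ∈ ball (ctr k g U).1 (R' k), ∀ p v, mq k i X * ‖v‖ ^ 2 - bq k i X ≤ ((𝔊 k i X).q o p v).re))
    {k : ℕ} {g : ℕ → ℝ} (hg : g ∈ Win) {U : C.BgB} {o : Op} {h₀ v : B13HistM P} {μ₁ : ℝ}
    (hO : ‖o - (ctr k g U).1‖ ≤ ROp k) (hH : ‖h₀ - (ctr k g U).2‖ + μ₁ * ‖v‖ ≤ RHist k)
    {emb : D.Dom → C.Dom} (hscale : ∀ Z, C.scale (emb Z) = k)
    {terms : D.Dom → Finset (Σ _ : Finset Cube, Σ F : Finset D.Dom, ∀ Z ∈ F, κ Z)} {act : ℂ → D.Dom → ℂ}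
    (hact : ∀ σ ∈ ball (0 : ℂ) μ₁, ∀ Z, act σ Z = ∑ i ∈ terms Z, (𝔊 k i (emb Z)).termAt o (h₀ + σ • v))
    {A Rkp r₁ b₅ μ₀ : ℝ} {X₀ : D.Dom} {sμ : ℂ} (hA : 0 ≤ A) (hr₁ : 0 ≤ r₁) (hb : r₁ * 5 ≤ b₅)
    (hrate : r₁ + 2 * G.κ₀ + 2 ≤ Rkp) (hsmall : A * Real.exp (b₅ + 1) * G.K₀ * G.ν * G.c₁ ≤ 1)
    (J : ∀ Z : D.Dom, Finset (κ Z)) (n : ∀ Z : D.Dom, κ Z → ℝ) (hn : ∀ Z j, 0 ≤ n Z j)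
    {a r R vW : ℝ} (ha : 0 ≤ a) (hvW : 0 ≤ vW)
    (hκ : G.κ₀ + 1 ≤ r) (h229 : Real.exp 1 * G.K₀ * G.c₁ * a ≤ 1)
    (hmember : ∀ Z', ∑ j ∈ J Z', n Z' j ≤ a * Real.exp (-(r * D.dj Z')) * Real.exp (-(R * (D.dj Z' + 5))))
    (unit : Cube → D.Dom) (hcubes : ∀ c, G.cubes (unit c) = {c}) {u₀ : ℝ} (hu₀ : ∀ c, D.dj (unit c) ≤ u₀)
    (hRR : Rkp ≤ R - G.c₁ * (vW * Real.exp (R * (5 + u₀))))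
    (hadm : ∀ Z, ∀ l ∈ terms Z, l.1 ⊆ G.cubes Z ∧
      l.2.1 ∈ coveringFamilies Finset.univ G.cubes (G.cubes Z \ l.1) ∧ ∀ Z' (h : Z' ∈ l.2.1), l.2.2 Z' h ∈ J Z')
    (hAmp : ∀ Z, G.cubes Z ⊆ G.cubes X₀ → ∀ l ∈ terms Z,
      (𝔊 k l (emb Z)).lam.real univ * ((𝔊 k l (emb Z)).wB * N₀ k l (emb Z) * Real.exp (bq k l (emb Z))) *
          (Real.pi / (mq k l (emb Z) / 2)) ^ (Module.finrank ℝ (α k l) / 2 : ℝ) *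
        Real.exp ((𝔊 k l (emb Z)).N₁ * (‖h₀‖ + μ₁ * ‖v‖)) ≤
      A * (vW ^ l.1.card * ∏ x ∈ l.2.1.attach, n x.1 (l.2.2 x.1 x.2)))
    (h0 : 0 < μ₀) (h01 : μ₀ < μ₁) (hμ : ‖sμ‖ ≤ μ₀) :
    ‖locE G.ι G.cubes (act sμ) (G.cubes X₀) - locE G.ι G.cubes (act 0) (G.cubes X₀)‖ ≤
      Real.exp 1 * G.ν * G.c₁ * G.K₀ ^ 2 * A * Real.exp (-(r₁ * D.dj X₀)) * (μ₀ / (μ₁ - μ₀)) :=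
  muPart_locE_le_of_coresAt_pencil_outerLabels D G 𝔊 hroom hm hN hq hg hO hH hscale hact hA hr₁ hb hrate hsmall J n hn ha hvW hκ
    h229 hmember (fun Z W hW F hF => link_of_ineq227' G unit hcubes hu₀ Z W hW F hF) hRR hadm hAmp h0 h01 hμ

end Outer

end End

/-! ## §3∕§4 ON THE TORUS OF THE PAPERS: NO link binder, NO geometry hypothesis, NO `hmono`; located numerals -/

section TorusInner

variable {N : ℕ} [NeZero N]
variable {C : Carriers} {P : MeasPotFrame C} {Op : Type*} [NormedAddCommGroup Op] [NormedSpace ℂ Op] {Bnd : Type} [DecidableEq Bnd]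
  {𝒴 : ℕ → (Σ _ : Finset (TPt 4 N), Finset (TDom 4 N) × Finset Bnd) → Type*} {dom : ∀ k i, 𝒴 k i → C.Dom}
  {β : ℕ → (Σ _ : Finset (TPt 4 N), Finset (TDom 4 N) × Finset Bnd) → Type*} [∀ k i, MeasurableSpace (β k i)]
  {α : ℕ → (Σ _ : Finset (TPt 4 N), Finset (TDom 4 N) × Finset Bnd) → Type*} [∀ k i, NormedAddCommGroup (α k i)]
  [∀ k i, InnerProductSpace ℝ (α k i)] [∀ k i, FiniteDimensional ℝ (α k i)] [∀ k i, MeasurableSpace (α k i)]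
  [∀ k i, BorelSpace (α k i)]

open Classical in
/-- **N0x P2's INNER-LABEL μ-END ON THE TORUS OF THE PAPERS — NO LINK BINDER, NO GEOMETRY HYPOTHESIS, NO `hmono`** (kernel; §1 at
`D = Dk := tsys 4 N`, `G = Gk := tgeometry 4 N`, `foot := id` (`hmono` by `le_rfl`), unit domains the single cubes (`u₀ = 0`, so
`c₃₂ = 5`), pv22's located letters by N0o's `torus_consts` ∕ S24's `K₀_four`: `ν = 9`, `κ₀ = 64·log 162`, `c₁ = 64`,
`K₀ = K₀(64,8)`, `b₅ := 5·r₁`): the inner labels `⟨W, (𝐃, P)⟩` of a torus polymer `Z` (`W ⊆ Z`, `𝐃` covering `Z ∖ W` by torus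
domains, `P ⊆ bondsOf W`, `#W ≤ 2·#P`), the per-label amplitude `hAmp` at the source radius `‖h₀‖ + μ₁‖v‖`, the bonds-per-cube
clause `hb₀`, and the clauses `64·log 162 + 1 ≤ δκ`, `e·K₀(64,8)·64·α₆ ≤ 1`, `r₁ + 2·(64 log 162) + 2 ≤ Rkp ≤
R − 64·(e^{5R}·s·e^{b₀t})`, `A·e^{5r₁+1}·K₀(64,8)·9·64 ≤ 1` stay DISPLAYED; for `0 < μ₀ < μ₁`, `‖sμ‖ ≤ μ₀`:
`‖E[act sμ](X₀) − E[act 0](X₀)‖ ≤ e·9·64·K₀(64,8)²·A·e^{−r₁·torusTreeLen X₀}·μ₀∕(μ₁ − μ₀)`. [folklore] -/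
theorem muPart_locE_le_of_coresAt_pencil_innerLabels_torus {Win : Set (ℕ → ℝ)}
    {ctr : ℕ → (ℕ → ℝ) → C.BgB → Op × B13HistM P} {ROp RHist R' : ℕ → ℝ}
    (𝔊 : ∀ k i, C.Dom → BiCore P (dom k i) Op (β k i) (α k i))
    {mq bq N₀ : ℕ → (Σ _ : Finset (TPt 4 N), Finset (TDom 4 N) × Finset Bnd) → C.Dom → ℝ}
    (hroom : ∀ k, ROp k < R' k)
    (hm : ∀ k, ∀ g ∈ Win, ∀ (U : C.BgB) (X : C.Dom), C.scale X = k → ∀ i, 0 < mq k i X)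
    (hN : ∀ k, ∀ g ∈ Win, ∀ (U : C.BgB) (X : C.Dom), C.scale X = k → ∀ i,
      (∀ o ∈ ball (ctr k g U).1 (R' k), AEStronglyMeasurable ((𝔊 k i X).N o) (𝔊 k i X).lam) ∧
      (∀ p, DifferentiableOn ℂ (fun o => (𝔊 k i X).N o p) (ball (ctr k g U).1 (R' k))) ∧
      (∀ o ∈ ball (ctr k g U).1 (R' k), ∀ p, ‖(𝔊 k i X).N o p‖ ≤ N₀ k i X))
    (hq : ∀ k, ∀ g ∈ Win, ∀ (U : C.BgB) (X : C.Dom), C.scale X = k → ∀ i,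
      (∀ o ∈ ball (ctr k g U).1 (R' k),
        AEStronglyMeasurable (Function.uncurry ((𝔊 k i X).q o)) ((𝔊 k i X).lam.prod volume)) ∧
      (∀ p v, DifferentiableOn ℂ (fun o => (𝔊 k i X).q o p v) (ball (ctr k g U).1 (R' k))) ∧
      (∀ o ∈ ball (ctr k g U).1 (R' k), ∀ p v, mq k i X * ‖v‖ ^ 2 - bq k i X ≤ ((𝔊 k i X).q o p v).re))
    {k : ℕ} {g : ℕ → ℝ} (hg : g ∈ Win) {U : C.BgB} {o : Op} {h₀ v : B13HistM P} {μ₁ : ℝ}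
    (hO : ‖o - (ctr k g U).1‖ ≤ ROp k) (hH : ‖h₀ - (ctr k g U).2‖ + μ₁ * ‖v‖ ≤ RHist k)
    {emb : (tsys 4 N).Dom → C.Dom} (hscale : ∀ Z, C.scale (emb Z) = k)
    {terms : (tsys 4 N).Dom → Finset (Σ _ : Finset (TPt 4 N), Finset (TDom 4 N) × Finset Bnd)}
    {act : ℂ → (tsys 4 N).Dom → ℂ}
    (hact : ∀ σ ∈ ball (0 : ℂ) μ₁, ∀ Z, act σ Z = ∑ i ∈ terms Z, (𝔊 k i (emb Z)).termAt o (h₀ + σ • v))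
    {A Rkp r₁ μ₀ : ℝ} (X₀ : (tsys 4 N).Dom) {sμ : ℂ} (hA : 0 ≤ A) (hr₁ : 0 ≤ r₁)
    (hrate : r₁ + 2 * (64 * Real.log 162) + 2 ≤ Rkp) (hsmall : A * Real.exp (5 * r₁ + 1) * K₀ 64 8 * 9 * 64 ≤ 1)
    (bondsOf : Finset (TPt 4 N) → Finset Bnd) {δ κ α₆ R b₀ s t : ℝ} (hα₆ : 0 ≤ α₆)
    (hκ : 64 * Real.log 162 + 1 ≤ δ * κ) (h229 : Real.exp 1 * K₀ 64 8 * 64 * α₆ ≤ 1)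
    (hs0 : 0 ≤ s) (hs1 : s ≤ 1) (ht : 0 ≤ t) (hb₀ : ∀ W, ((bondsOf W).card : ℝ) ≤ b₀ * W.card)
    (hRR : Rkp ≤ R - 64 * (Real.exp (R * 5) * s * Real.exp (b₀ * t)))
    (hadm : ∀ Z : (tsys 4 N).Dom, ∀ l ∈ terms Z, l.1 ⊆ Z.1 ∧
      l.2.1 ∈ coveringFamilies Finset.univ (fun Y : (tsys 4 N).Dom => Y.1) (Z.1 \ l.1) ∧ l.2.2 ⊆ bondsOf l.1 ∧
        l.1.card ≤ 2 * l.2.2.card)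
    (hAmp : ∀ Z : (tsys 4 N).Dom, Z.1 ⊆ X₀.1 → ∀ l ∈ terms Z,
      (𝔊 k l (emb Z)).lam.real univ * ((𝔊 k l (emb Z)).wB * N₀ k l (emb Z) * Real.exp (bq k l (emb Z))) *
          (Real.pi / (mq k l (emb Z) / 2)) ^ (Module.finrank ℝ (α k l) / 2 : ℝ) *
        Real.exp ((𝔊 k l (emb Z)).N₁ * (‖h₀‖ + μ₁ * ‖v‖)) ≤
      A * ((∏ Y ∈ l.2.1, (α₆ * Real.exp (-(δ * κ * torusTreeLen Y.1)) *
        Real.exp (-(R * (torusTreeLen Y.1 + 5))))) * (s ^ 2 * t) ^ l.2.2.card))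
    (h0 : 0 < μ₀) (h01 : μ₀ < μ₁) (hμ : ‖sμ‖ ≤ μ₀) :
    ‖locE (TTouch (d := 4) (N := N)) (fun Z : (tsys 4 N).Dom => Z.1) (act sμ) X₀.1 -
        locE (TTouch (d := 4) (N := N)) (fun Z : (tsys 4 N).Dom => Z.1) (act 0) X₀.1‖ ≤
      Real.exp 1 * 9 * 64 * K₀ 64 8 ^ 2 * A * Real.exp (-(r₁ * torusTreeLen X₀.1)) * (μ₀ / (μ₁ - μ₀)) := by
  obtain ⟨hν, hκ₀, hc⟩ := torus_consts N
  have hK₀ := K₀_four (N := N)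
  have hdom : ∀ a : TPt 4 N, IsTDom ({a} : Finset (TPt 4 N)) := fun a =>
    ⟨Finset.singleton_nonempty a, fun x hx y hy => by
      rw [Finset.mem_singleton] at hx hy; subst hx; subst hy; exact Relation.ReflTransGen.refl⟩
  have h := muPart_locE_le_of_coresAt_pencil_innerLabels_of_units (tsys 4 N) (tgeometry 4 N) (tgeometry 4 N) 𝔊 hroom hm hN hq hg
    hO hH hscale hact (Rkp := Rkp) (b₅ := 5 * r₁) (X₀ := X₀) (sμ := sμ) hA hr₁ (le_of_eq (by ring)) (by rw [hκ₀]; exact hrate)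
    (by rw [hK₀, hν, hc]; exact hsmall) id (fun _ => le_rfl) bondsOf hα₆ (by rw [hκ₀]; exact hκ) (by rw [hK₀, hc]; exact h229)
    hs0 hs1 ht hb₀ (fun a => (⟨{a}, hdom a⟩ : TDom 4 N)) (fun _ => rfl) (u₀ := 0) (fun a => le_of_eq (torusTreeLen_singleton a))
    (by rw [hc, show (5 : ℝ) + 0 = 5 by norm_num]; exact hRR) hadm hAmp h0 h01 hμ
  rw [hν, hc, hK₀] at h
  exact h

end TorusInner

section TorusOuter

variable {N : ℕ} [NeZero N]
variable {C : Carriers} {P : MeasPotFrame C} {Op : Type*} [NormedAddCommGroup Op] [NormedSpace ℂ Op] {κ : TDom 4 N → Type}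
  {𝒴 : ℕ → (Σ _ : Finset (TPt 4 N), Σ F : Finset (TDom 4 N), ∀ Z ∈ F, κ Z) → Type*} {dom : ∀ k i, 𝒴 k i → C.Dom}
  {β : ℕ → (Σ _ : Finset (TPt 4 N), Σ F : Finset (TDom 4 N), ∀ Z ∈ F, κ Z) → Type*} [∀ k i, MeasurableSpace (β k i)]
  {α : ℕ → (Σ _ : Finset (TPt 4 N), Σ F : Finset (TDom 4 N), ∀ Z ∈ F, κ Z) → Type*} [∀ k i, NormedAddCommGroup (α k i)]
  [∀ k i, InnerProductSpace ℝ (α k i)] [∀ k i, FiniteDimensional ℝ (α k i)] [∀ k i, MeasurableSpace (α k i)]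
  [∀ k i, BorelSpace (α k i)]

open Classical in
/-- **N0x P2's OUTER-LABEL μ-END ON THE TORUS OF THE PAPERS — NO LINK BINDER, NO GEOMETRY HYPOTHESIS** (kernel; §2 at
`D := tsys 4 N`, `G := tgeometry 4 N`, unit domains the single cubes (`u₀ = 0`, so `c' = 5`), pv22's located letters by `torus_consts`
∕ `K₀_four`, `b₅ := 5·r₁`): the displayed clauses read `64·log 162 + 1 ≤ r`, `e·K₀(64,8)·64·a ≤ 1`, `r₁ + 2·(64 log 162) + 2 ≤ Rkp ≤
R − 64·(vW·e^{5R})`, `A·e^{5r₁+1}·K₀(64,8)·9·64 ≤ 1`; `hmember`∕`J`∕`n`∕`hadm`∕`hAmp` DISPLAYED; for `0 < μ₀ < μ₁`, `‖sμ‖ ≤ μ₀`: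
`‖E[act sμ](X₀) − E[act 0](X₀)‖ ≤ e·9·64·K₀(64,8)²·A·e^{−r₁·torusTreeLen X₀}·μ₀∕(μ₁ − μ₀)`. [folklore] -/
theorem muPart_locE_le_of_coresAt_pencil_outerLabels_torus {Win : Set (ℕ → ℝ)}
    {ctr : ℕ → (ℕ → ℝ) → C.BgB → Op × B13HistM P} {ROp RHist R' : ℕ → ℝ}
    (𝔊 : ∀ k i, C.Dom → BiCore P (dom k i) Op (β k i) (α k i))
    {mq bq N₀ : ℕ → (Σ _ : Finset (TPt 4 N), Σ F : Finset (TDom 4 N), ∀ Z ∈ F, κ Z) → C.Dom → ℝ}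
    (hroom : ∀ k, ROp k < R' k)
    (hm : ∀ k, ∀ g ∈ Win, ∀ (U : C.BgB) (X : C.Dom), C.scale X = k → ∀ i, 0 < mq k i X)
    (hN : ∀ k, ∀ g ∈ Win, ∀ (U : C.BgB) (X : C.Dom), C.scale X = k → ∀ i,
      (∀ o ∈ ball (ctr k g U).1 (R' k), AEStronglyMeasurable ((𝔊 k i X).N o) (𝔊 k i X).lam) ∧
      (∀ p, DifferentiableOn ℂ (fun o => (𝔊 k i X).N o p) (ball (ctr k g U).1 (R' k))) ∧
      (∀ o ∈ ball (ctr k g U).1 (R' k), ∀ p, ‖(𝔊 k i X).N o p‖ ≤ N₀ k i X))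
    (hq : ∀ k, ∀ g ∈ Win, ∀ (U : C.BgB) (X : C.Dom), C.scale X = k → ∀ i,
      (∀ o ∈ ball (ctr k g U).1 (R' k),
        AEStronglyMeasurable (Function.uncurry ((𝔊 k i X).q o)) ((𝔊 k i X).lam.prod volume)) ∧
      (∀ p v, DifferentiableOn ℂ (fun o => (𝔊 k i X).q o p v) (ball (ctr k g U).1 (R' k))) ∧
      (∀ o ∈ ball (ctr k g U).1 (R' k), ∀ p v, mq k i X * ‖v‖ ^ 2 - bq k i X ≤ ((𝔊 k i X).q o p v).re))
    {k : ℕ} {g : ℕ → ℝ} (hg : g ∈ Win) {U : C.BgB} {o : Op} {h₀ v : B13HistM P} {μ₁ : ℝ}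
    (hO : ‖o - (ctr k g U).1‖ ≤ ROp k) (hH : ‖h₀ - (ctr k g U).2‖ + μ₁ * ‖v‖ ≤ RHist k)
    {emb : (tsys 4 N).Dom → C.Dom} (hscale : ∀ Z, C.scale (emb Z) = k)
    {terms : (tsys 4 N).Dom → Finset (Σ _ : Finset (TPt 4 N), Σ F : Finset (TDom 4 N), ∀ Z ∈ F, κ Z)}
    {act : ℂ → (tsys 4 N).Dom → ℂ}
    (hact : ∀ σ ∈ ball (0 : ℂ) μ₁, ∀ Z, act σ Z = ∑ i ∈ terms Z, (𝔊 k i (emb Z)).termAt o (h₀ + σ • v))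
    {A Rkp r₁ μ₀ : ℝ} (X₀ : (tsys 4 N).Dom) {sμ : ℂ} (hA : 0 ≤ A) (hr₁ : 0 ≤ r₁)
    (hrate : r₁ + 2 * (64 * Real.log 162) + 2 ≤ Rkp) (hsmall : A * Real.exp (5 * r₁ + 1) * K₀ 64 8 * 9 * 64 ≤ 1)
    (J : ∀ Z : TDom 4 N, Finset (κ Z)) (n : ∀ Z : TDom 4 N, κ Z → ℝ) (hn : ∀ Z j, 0 ≤ n Z j)
    {a r R vW : ℝ} (ha : 0 ≤ a) (hvW : 0 ≤ vW)
    (hκ : 64 * Real.log 162 + 1 ≤ r) (h229 : Real.exp 1 * K₀ 64 8 * 64 * a ≤ 1)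
    (hmember : ∀ Z' : (tsys 4 N).Dom, ∑ j ∈ J Z', n Z' j ≤
      a * Real.exp (-(r * torusTreeLen Z'.1)) * Real.exp (-(R * (torusTreeLen Z'.1 + 5))))
    (hRR : Rkp ≤ R - 64 * (vW * Real.exp (R * 5)))
    (hadm : ∀ Z : (tsys 4 N).Dom, ∀ l ∈ terms Z, l.1 ⊆ Z.1 ∧
      l.2.1 ∈ coveringFamilies Finset.univ (fun Y : (tsys 4 N).Dom => Y.1) (Z.1 \ l.1) ∧
        ∀ Z' (h : Z' ∈ l.2.1), l.2.2 Z' h ∈ J Z')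
    (hAmp : ∀ Z : (tsys 4 N).Dom, Z.1 ⊆ X₀.1 → ∀ l ∈ terms Z,
      (𝔊 k l (emb Z)).lam.real univ * ((𝔊 k l (emb Z)).wB * N₀ k l (emb Z) * Real.exp (bq k l (emb Z))) *
          (Real.pi / (mq k l (emb Z) / 2)) ^ (Module.finrank ℝ (α k l) / 2 : ℝ) *
        Real.exp ((𝔊 k l (emb Z)).N₁ * (‖h₀‖ + μ₁ * ‖v‖)) ≤
      A * (vW ^ l.1.card * ∏ x ∈ l.2.1.attach, n x.1 (l.2.2 x.1 x.2)))
    (h0 : 0 < μ₀) (h01 : μ₀ < μ₁) (hμ : ‖sμ‖ ≤ μ₀) :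
    ‖locE (TTouch (d := 4) (N := N)) (fun Z : (tsys 4 N).Dom => Z.1) (act sμ) X₀.1 -
        locE (TTouch (d := 4) (N := N)) (fun Z : (tsys 4 N).Dom => Z.1) (act 0) X₀.1‖ ≤
      Real.exp 1 * 9 * 64 * K₀ 64 8 ^ 2 * A * Real.exp (-(r₁ * torusTreeLen X₀.1)) * (μ₀ / (μ₁ - μ₀)) := by
  obtain ⟨hν, hκ₀, hc⟩ := torus_consts N
  have hK₀ := K₀_four (N := N)
  have hdom : ∀ p : TPt 4 N, IsTDom ({p} : Finset (TPt 4 N)) := fun p =>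
    ⟨Finset.singleton_nonempty p, fun x hx y hy => by
      rw [Finset.mem_singleton] at hx hy; subst hx; subst hy; exact Relation.ReflTransGen.refl⟩
  have h := muPart_locE_le_of_coresAt_pencil_outerLabels_of_units (tsys 4 N) (tgeometry 4 N) 𝔊 hroom hm hN hq hg hO hH hscale hact
    (Rkp := Rkp) (b₅ := 5 * r₁) (X₀ := X₀) (sμ := sμ) hA hr₁ (le_of_eq (by ring)) (by rw [hκ₀]; exact hrate)
    (by rw [hK₀, hν, hc]; exact hsmall) J n hn ha hvW (by rw [hκ₀]; exact hκ) (by rw [hK₀, hc]; exact h229) hmember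
    (fun p => (⟨{p}, hdom p⟩ : TDom 4 N)) (fun _ => rfl) (u₀ := 0) (fun p => le_of_eq (torusTreeLen_singleton p))
    (by rw [hc, show (5 : ℝ) + 0 = 5 by norm_num]; exact hRR) hadm hAmp h0 h01 hμ
  rw [hν, hc, hK₀] at h
  exact h

end TorusOuter

end Summit.QuantumFields.BalabanUV.T4Continuum.NE1p.DressedSmallFieldLinkMu

end
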